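import Summits.ABC.IUTFork.Thm311RealInd1StripPacketThetaJunctionBit
import Literature.IUT.LogVolume.PacketMonomialBox
import HarnessLib

/-!
# [IUTchIII] Thm 3.11 (i) (Ind1)+(Ind2) ⟶ Cor 3.12 Step (x), reading (P): the packet–Θ junction from ANY depth profile inside the ARITHMETIC ROOM
# of the Θ-region `ι_{i₀}(g)·(R_I)^∼` — `(R_I)^∼ ⊋ R_I` TRANSFERS depth between factors, so the depth-`e` bit is needed only where a chosen profile
# has full depth at residue degree one; NO bit when `(r+2)/e_{i₀} + Σ_{i≠i₀} 1/e_i ≤ 1`; ONE bit anywhere when `(r+1)/e_{i₀} + Σ_{i≠b} 1/e_i ≤ 1`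

PROOF-ONLY file (abc-iut cell, Cor. 3.12 sub-crew, seat abc-iut-c312-1 = holder of record of the typed [IUTchIII] Thm. 3.11, gen 19; row «R25 =
C:NORMALISATION-TRANSFER», KEY NORMTRANSFER, C LEAD ruling C-R167 (a); file (A)).  TAKES NO SIDE on [IUTchIII] Cor. 3.12.  No definition, no `Prop`
fact; `JannsenWingbergMappingClass` is the only conditional input (binder `hMC`, used through p551614's branch-(i) packet floor).
SETTING (R21/R22/R24 = p538494 / p541705 / p552192, BY NAME).  Genuine packet `X = ⊗_{ℚ_p, i} K_{w_i}`, every factor TAME of ODD local degree `≥ 3`;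
slot `i₀`, `‖g‖ = p^{−v/e_{i₀}}`; `A = (v − 1) div e_{i₀} + 1 − |I|`, `r = (v − 1) mod e_{i₀}`; `H ≤ indTwo` containing the single-factor strip moves.
R24 (p552192 §1) proved `packetHull(⋃_{γ∈H} γ(ι_{i₀}(g)·(R_I)^∼)) = packetHull(p^{A}·log_p(R_I^×))` from the BOX `ι_{i₀}(g)·R_I`, whose off-slot factor
balls `p⁻¹·𝔪^{e_i}` have FULL depth — whence one bit per off-slot factor of residue degree one.  But `(R_I)^∼` contains every pure tensor of total
norm `≤ 1` (abc-iut-E-t58 `MonomialBox.purePacket_mem_normalizedPacket_of_prod_norm_le`: the monomials `π_{i₀}^{−a} ⊗ ⊗_{i≠i₀} π_i^{b_i}`,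
`a/e_{i₀} ≤ Σ b_i/e_i`), so the Θ-region contains EVERY product of factor balls `c_i·𝔪^{n_i}` with `∏ c_i = p^{A}` and `v/e_{i₀} − A ≤ Σ n_i/e_i`.
* §1 **`…_eq_of_profile_of_jannsenWingbergMappingClass`** — for EVERY depth profile `1 ≤ n_i ≤ e_i` inside the room `v/e_{i₀} − A ≤ Σ_i n_i/e_i`,
  the bit displayed ONLY where `n_i = e_i ∧ f(w_i|p) = 1`: the junction identity (p551614's floor on the span of the `H`-orbit; container = star
  form).  p552192 §1 IS the box profile `n = (r+1; e_i (i ≠ i₀))` (room with equality) — subsumed BY NAME.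
* §2 **`…_eq_of_bitsOn_of_jannsenWingbergMappingClass`** — the TRANSFER form: bits available on ANY set `S` of factors and the room inequality
  `(r+1)/e_{i₀} + Σ_{i∉S} 1/e_i ≤ 1` (profile `n_i = e_i` on `S`, `e_i − 1` off `S`).  `S = ∅` = NO bit (`(r+2)/e_{i₀} + Σ_{i≠i₀} 1/e_i ≤ 1`), `S = {b}` =
  ONE bit anywhere (`(r+1)/e_{i₀} + Σ_{i≠b} 1/e_i ≤ 1`; two equally ramified factors: `r ≤ e − 2`, the bit at EITHER factor) — displayed verbatim,
  with the place-section ports, in the companion `Thm311RealInd1StripPacketMonomialFloorForms`.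
READING (numbers about OUR typed objects; neutral): R24's per-factor bit family is SUFFICIENT but at packets of `≥ 2` ramified factors NOT NECESSARY as
typed; file (B) `Thm311RealInd1StripPacketNormalisationTransfer` gives the UNCONDITIONAL converses on the two-factor example (sharp exactly when
`e ∣ v`).  HONEST SCOPE as in R21–R24: OUR typings (THE equivariant lift, THE logarithm, factorwise action; F-B28-1 untouched); conditional on `hMC`;
EVEN local degree (NOT typed), WILD, `p = 2` remain; nothing here decides any bit; equal-AS-TYPED ≠ equal in print; nothing here asserts that abc is
proved or refuted; no side taken on [IUTchIII] Cor. 3.12 / [IUTchIV] Thm. 1.10, on (U) vs (P), or on any author. [claim: Mochizuki2012, status: disputed];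
[cite: Mochizuki2012, IUTchIII Thm. 3.11 (i) p. 154; Rmk. 3.9.5 (i) p. 127; Cor. 3.12 Step (x)/(xi) pp. 181–183; IUTchIV Prop. 1.1 p. 9, Prop. 1.2 (ii) pp. 10–11];
[cite: Kondo2025OuterAutMLF, §3 Thm 3.17, Rem 3.18]; [cite: DupuyHilado2025, §4.9, §4.12]. typed ≠ proved; a conditional theorem discharges nothing it binds.
-/

set_option autoImplicit false

noncomputable section

open Metric Set Function
open scoped Pointwise TensorProduct

namespace Summit.ABC.IUTFork.Thm311.Real

open NumberField IsDedekindDomain Literature.NumberTheory.NumberFields Literature.IUT.LogVolume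
open Literature.NumberTheory.GaloisRepresentations Literature.NumberTheory.GaloisRepresentations.Ultrametric
open Literature.AnabelianGeometry.AbsoluteAnabelian Literature.IUT.HodgeArakelov
open Literature.IUT.HodgeArakelov.AbsTopMonoids

/-! ## §1 Packet level: the junction from ANY depth profile inside the arithmetic room -/

section GenuineFactors

variable {K : Type} [Field K] [NumberField K] (p : ℕ) [hp : Fact p.Prime]
variable {I : Type} [Fintype I] [DecidableEq I] (w : I → HeightOneSpectrum (𝓞 K)) (hw : ∀ i, ((p : ℕ) : 𝓞 K) ∈ (w i).asIdeal)

/-- **PRINT SIDE — THE JUNCTION at the packet from ANY DEPTH PROFILE inside the arithmetic room (modulo `JannsenWingbergMappingClass`).**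
Packet of R21/R22/R24: every factor TAME of ODD local degree `≥ 3`, `‖g‖ = p^{−v/e_{i₀}}`, `A = (v − 1) div e_{i₀} + 1 − |I|`.  A DEPTH PROFILE is a
family of factor balls `{‖x‖ ≤ ‖c_i‖·p^{−n_i/e_i}} = c_i·𝔪^{n_i}` (`c_i ∈ ℚ_p^×`, `1 ≤ n_i ≤ e_i`) of total content `∏ c_i = p^{A}`; it lies INSIDE THE
ROOM of the Θ-region `ι_{i₀}(g)·(R_I)^∼` when `‖g‖⁻¹·∏_i ‖c_i‖·p^{−n_i/e_i} ≤ 1` — then every product of the balls is `ι_{i₀}(g)·⊗ y_i` with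
`∏‖y_i‖ ≤ 1`, a pure tensor of `(R_I)^∼` (`MonomialBox.purePacket_mem_normalizedPacket_of_prod_norm_le`).  If at every factor where the profile has
FULL depth `n_i = e_i` and the residue degree is one some realised strip automorphism moves `ℤ_p·p` modulo `p·log_p(𝒪_{w_i}^×)` (`hbit`, displayed),
then for every `H ≤ indTwo` containing the single-factor strip moves the `(R_I)^∼`-hull of the `H`-orbit of `ι_{i₀}(g)·(R_I)^∼` IS
`packetHull(p^{A}·log_p(R_I^×))` (floor: p551614 on the additive span of the orbit; container: the star form).  p552192 §1 is the box profile
`c = (p^{(v−1) div e}; p⁻¹…)`, `n = (r+1; e_i…)`. [claim: Mochizuki2012, status: disputed]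
[cite: Mochizuki2012, IUTchIII Thm. 3.11 (i) p. 154; Rmk. 3.9.5 (i) p. 127; Cor. 3.12 Step (xi) p. 183; IUTchIV Prop. 1.1 p. 9, Prop. 1.2 (ii) p. 10–11]
[cite: Kondo2025OuterAutMLF, §3 Thm 3.17, Rem 3.18] [cite: DupuyHilado2025, §4.9, §4.12] -/
theorem packetHull_iUnion_image_iota_smul_normalizedPacket_eq_of_profile_of_jannsenWingbergMappingClass [Nonempty I]
    (hMC : JannsenWingbergMappingClass) (hp2 : 2 < p)
    (he : ∀ i, absRamificationIdx p (RescaledCompletion K p (w i) (hw i)) ≤ p - 2)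
    (h3 : ∀ i, 3 ≤ localDeg K (w i)) (hodd : ∀ i, Odd (localDeg K (w i)))
    (i₀ : I) {g : RescaledCompletion K p (w i₀) (hw i₀)} {v : ℤ}
    (hv : ‖g‖ = (p : ℝ) ^ (-(v / (absRamificationIdx p (RescaledCompletion K p (w i₀) (hw i₀)) : ℝ))))
    (n : I → ℕ) (hn1 : ∀ i, 1 ≤ n i) (hne : ∀ i, n i ≤ absRamificationIdx p (RescaledCompletion K p (w i) (hw i)))
    (hroom : (v : ℝ) / (absRamificationIdx p (RescaledCompletion K p (w i₀) (hw i₀)) : ℝ) -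
        (((v - 1) / (absRamificationIdx p (RescaledCompletion K p (w i₀) (hw i₀)) : ℤ) + 1 - Fintype.card I : ℤ) : ℝ) ≤
      ∑ i, (n i : ℝ) / (absRamificationIdx p (RescaledCompletion K p (w i) (hw i)) : ℝ))
    (hbit : ∀ i, n i = absRamificationIdx p (RescaledCompletion K p (w i) (hw i)) → (w i).asIdeal.inertiaDeg ℤ = 1 →
      ∃ ψ ∈ ind1StripOf (w i) (galoisLog (w i)),
        RescaledCompletion.of K p (w i) (hw i) (ψ (p : (w i).adicCompletion K)) - (p : RescaledCompletion K p (w i) (hw i)) ∉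
          (p : ℚ_[p]) • logUnits (RescaledCompletion K p (w i) (hw i)))
    (H : Subgroup (PacketAlgebra p (fun i => RescaledCompletion K p (w i) (hw i)) ≃ₗ[ℚ_[p]]
      PacketAlgebra p (fun i => RescaledCompletion K p (w i) (hw i))))
    (hH : H ≤ indTwo p (fun i => RescaledCompletion K p (w i) (hw i)))
    (hstrip : ∀ (i₁ : I), ∀ ψ ∈ ind1StripOf (w i₁) (galoisLog (w i₁)), ∃ γ ∈ H,
      ∀ z : Π i, RescaledCompletion K p (w i) (hw i),
        (γ : PacketAlgebra p (fun i => RescaledCompletion K p (w i) (hw i)) ≃ₗ[ℚ_[p]]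
            PacketAlgebra p (fun i => RescaledCompletion K p (w i) (hw i))) (PiTensorProduct.tprod ℚ_[p] z) =
          PiTensorProduct.tprod ℚ_[p] (update z i₁ (RescaledCompletion.of K p (w i₁) (hw i₁)
            (ψ ((RescaledCompletion.of K p (w i₁) (hw i₁)).symm (z i₁)))))) :
    packetHull p (fun i => RescaledCompletion K p (w i) (hw i))
        (⋃ γ : H, (γ : PacketAlgebra p (fun i => RescaledCompletion K p (w i) (hw i)) ≃ₗ[ℚ_[p]]
            PacketAlgebra p (fun i => RescaledCompletion K p (w i) (hw i))) ''
          (iota p (fun i => RescaledCompletion K p (w i) (hw i)) i₀ g •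
            (normalizedPacket p (fun i => RescaledCompletion K p (w i) (hw i)) :
              Set (PacketAlgebra p (fun i => RescaledCompletion K p (w i) (hw i)))))) =
      packetHull p (fun i => RescaledCompletion K p (w i) (hw i))
        (((p : ℚ_[p]) ^ ((v - 1) / (absRamificationIdx p (RescaledCompletion K p (w i₀) (hw i₀)) : ℤ) + 1 - Fintype.card I)) •
          (logPacket p (fun i => RescaledCompletion K p (w i) (hw i)) :
            Set (PacketAlgebra p (fun i => RescaledCompletion K p (w i) (hw i))))) := by
  classical
  set k := fun i => RescaledCompletion K p (w i) (hw i) with hk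
  set e := fun i => RescaledCompletion.of K p (w i) (hw i) with he_def
  set E : ℕ := absRamificationIdx p (k i₀) with hE
  set A : ℤ := (v - 1) / (E : ℤ) + 1 - Fintype.card I with hA
  set L : Set (PacketAlgebra p k) := (logPacket p k : Set (PacketAlgebra p k)) with hL
  set M : Set (PacketAlgebra p k) := iota p k i₀ g • (normalizedPacket p k : Set (PacketAlgebra p k)) with hM
  set O : Set (PacketAlgebra p k) := ⋃ γ : H, (γ : PacketAlgebra p k ≃ₗ[ℚ_[p]] PacketAlgebra p k) '' M with hO
  set N : AddSubgroup (PacketAlgebra p k) := AddSubgroup.closure O with hN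
  have hP : p.Prime := Fact.out
  have hp0 : (0 : ℝ) < p := by exact_mod_cast hP.pos
  have hp1 : (1 : ℝ) ≤ p := by exact_mod_cast hP.one_lt.le
  have hpQ : (p : ℚ_[p]) ≠ 0 := by exact_mod_cast hP.ne_zero
  have hg0 : g ≠ 0 := norm_pos_iff.mp (by rw [hv]; positivity)
  -- the profile's contents: `p^A` at the slot, `1` elsewhere (only `∏ c_i = p^A` and `Σ n_i/e_i` matter)
  let c : I → ℚ_[p] := fun i => if i = i₀ then (p : ℚ_[p]) ^ A else 1
  have hc : ∀ i, c i ≠ 0 := by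
    intro i; by_cases hi : i = i₀
    · simp only [c, if_pos hi]; exact zpow_ne_zero _ hpQ
    · simp only [c, if_neg hi]; exact one_ne_zero
  have hprod : ∏ i, c i = (p : ℚ_[p]) ^ A := by
    rw [← Finset.mul_prod_erase Finset.univ c (Finset.mem_univ i₀)]
    simp only [c, if_pos rfl]
    rw [Finset.prod_congr rfl (fun i hi => show c i = 1 by simp only [c, if_neg (Finset.ne_of_mem_erase hi)]),
      Finset.prod_const_one, mul_one]
  -- the room, multiplicatively: `‖g‖⁻¹·∏ ‖c_i‖·p^{−n_i/e_i} = p^{v/E − A − Σ n_i/e_i} ≤ 1`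
  have hfac : ∀ i, ‖c i‖ * (p : ℝ) ^ (-((n i : ℝ) / (absRamificationIdx p (k i) : ℝ))) =
      (p : ℝ) ^ ((if i = i₀ then -(A : ℝ) else 0) - (n i : ℝ) / (absRamificationIdx p (k i) : ℝ)) := by
    intro i
    by_cases hi : i = i₀
    · subst hi
      simp only [c, if_pos rfl]
      rw [norm_zpow, Padic.norm_p, inv_zpow', ← Real.rpow_intCast, ← Real.rpow_add hp0]
      push_cast
      ring_nf
    · simp only [c, if_neg hi, norm_one, one_mul]
      ring_nf
  have hroomx : ‖g‖⁻¹ * ∏ i, (‖c i‖ * (p : ℝ) ^ (-((n i : ℝ) / (absRamificationIdx p (k i) : ℝ)))) ≤ 1 := by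
    rw [Finset.prod_congr rfl (fun i _ => hfac i), ← Real.rpow_sum_of_pos hp0, hv, ← Real.rpow_neg hp0.le, neg_neg,
      ← Real.rpow_add hp0]
    refine Real.rpow_le_one_of_one_le_of_nonpos hp1 ?_
    rw [Finset.sum_sub_distrib, Finset.sum_ite_eq' Finset.univ i₀, if_pos (Finset.mem_univ _)]
    have hA' : (((v - 1) / (absRamificationIdx p (RescaledCompletion K p (w i₀) (hw i₀)) : ℤ) + 1 - Fintype.card I : ℤ) : ℝ) = (A : ℝ) := by
      rw [hA]
    rw [hA'] at hroom
    change (v : ℝ) / (E : ℝ) - (A : ℝ) ≤ ∑ i, (n i : ℝ) / (absRamificationIdx p (k i) : ℝ) at hroom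
    change (v : ℝ) / (E : ℝ) + (-(A : ℝ) - ∑ i, (n i : ℝ) / (absRamificationIdx p (k i) : ℝ)) ≤ 0
    linarith
  -- container side: `M ⊆ p^A·L`, hence `O ⊆ p^A·L` and `N ⊆ p^A·L ⊆ packetHull(p^A·L)`
  obtain ⟨hMA, -⟩ := packetHull_iUnion_image_iota_smul_normalizedPacket_subset_of_tame p w hw hp2 he i₀ hv H hH
  have hOA : O ⊆ ((p : ℚ_[p]) ^ A) • L := by
    refine Set.iUnion_subset fun γ => ?_
    calc (γ : PacketAlgebra p k ≃ₗ[ℚ_[p]] PacketAlgebra p k) '' M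
        ⊆ (γ : PacketAlgebra p k ≃ₗ[ℚ_[p]] PacketAlgebra p k) '' (((p : ℚ_[p]) ^ A) • L) := Set.image_mono hMA
      _ = ((p : ℚ_[p]) ^ A) • L := image_const_smul_logPacket_of_mem_indTwo p k (hH γ.2) _
  have hNA : (N : Set (PacketAlgebra p k)) ⊆ ((p : ℚ_[p]) ^ A) • L := by
    have h : N ≤ ((p : ℚ_[p]) ^ A) • logPacket p k :=
      (AddSubgroup.closure_le _).mpr (by rw [AddSubgroup.coe_pointwise_smul]; exact hOA)
    intro x hx
    have hx' : x ∈ ((p : ℚ_[p]) ^ A) • logPacket p k := h hx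
    rwa [← SetLike.mem_coe, AddSubgroup.coe_pointwise_smul] at hx'
  -- the pure tensors of the profile lie in `M ⊆ O ⊆ N` (the room inequality + E-t58's monomial membership)
  have hMO : M ⊆ O := by
    intro x hx
    refine Set.mem_iUnion.mpr ⟨(1 : H), ?_⟩
    rw [OneMemClass.coe_one, LinearEquiv.coe_one, Set.image_id]
    exact hx
  have hbox : ∀ x : Π i, (w i).adicCompletion K,
      (∀ i, ‖e i (x i)‖ ≤ ‖c i‖ * (p : ℝ) ^ (-((n i : ℝ) / (absRamificationIdx p (k i) : ℝ)))) →
      PiTensorProduct.tprod ℚ_[p] (fun i => e i (x i)) ∈ N := by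
    intro x hx
    refine AddSubgroup.subset_closure (hMO ?_)
    -- `⊗ x = ι_{i₀}(g)·⊗ y`, `y = x[i₀ ↦ g⁻¹ x_{i₀}]`, `∏ ‖y_i‖ ≤ 1` by the room inequality
    let y : Π i, k i := update (fun i => e i (x i)) i₀ (g⁻¹ * e i₀ (x i₀))
    have hy1 : ∏ i, ‖y i‖ ≤ 1 := by
      have hsplit : ∏ i, ‖y i‖ = ‖g‖⁻¹ * ∏ i, ‖e i (x i)‖ := by
        rw [Finset.prod_eq_mul_prod_sdiff_singleton_of_mem (Finset.mem_univ i₀) (fun i => ‖y i‖),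
          Finset.prod_eq_mul_prod_sdiff_singleton_of_mem (Finset.mem_univ i₀) (fun i => ‖e i (x i)‖)]
        simp only [y, update_self, norm_mul, norm_inv, mul_assoc]
        congr 2
        refine Finset.prod_congr rfl fun i hi => ?_
        have hne' : i ≠ i₀ := fun h => (Finset.mem_sdiff.mp hi).2 (Finset.mem_singleton.mpr h)
        rw [update_of_ne hne']
      rw [hsplit]
      refine le_trans ?_ hroomx
      refine mul_le_mul_of_nonneg_left ?_ (inv_nonneg.mpr (norm_nonneg _))
      exact Finset.prod_le_prod (fun i _ => norm_nonneg _) fun i _ => hx i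
    refine ⟨purePacket p k y, MonomialBox.purePacket_mem_normalizedPacket_of_prod_norm_le p k hy1, ?_⟩
    show iota p k i₀ g * purePacket p k y = PiTensorProduct.tprod ℚ_[p] (fun i => e i (x i))
    rw [iota_mul_purePacket]
    simp only [y, update_self, update_idem, mul_inv_cancel_left₀ hg0, update_eq_self]
    rfl
  -- `N` is stable under the single-factor strip moves (realised in `H`; the span of the `H`-orbit is `H`-stable)
  have hNstrip : ∀ (i₁ : I), ∀ ψ ∈ ind1StripOf (w i₁) (galoisLog (w i₁)), ∀ z : Π i, k i,
      PiTensorProduct.tprod ℚ_[p] z ∈ N →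
        PiTensorProduct.tprod ℚ_[p] (update z i₁ (e i₁ (ψ ((e i₁).symm (z i₁))))) ∈ N := by
    intro i₁ ψ hψ z hz
    obtain ⟨γ₀, hγ₀H, hγ₀⟩ := hstrip i₁ ψ hψ
    have h := map_closure_iUnion_image_le p k M H hγ₀H ⟨_, hz, rfl⟩
    change γ₀ (PiTensorProduct.tprod ℚ_[p] z) ∈ N at h
    rwa [hγ₀ z] at h
  -- the packet floor on `N`
  have hNc : (N : Set (PacketAlgebra p k)) ⊆ packetHull p k ((∏ i, c i) • L) := by
    rw [hprod]; exact hNA.trans (subset_packetHull p k _)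
  have hfloor := packetHull_eq_of_balls_bit_of_jannsenWingbergMappingClass p w hw hMC hp2 he h3 hodd c hc n hn1 hne
    hbit N hbox hNstrip hNc
  rw [hprod] at hfloor
  rw [← packetHull_coe_closure_eq p k O]
  exact hfloor

/-! ## §2 Packet level: bits available on a SET of factors `S`, under the room inequality `(r+1)/e_{i₀} + Σ_{i∉S} 1/e_i ≤ 1` (depth transfer) -/

/-- **PRINT SIDE — THE TRANSFER FORM: bits on a set `S` of factors (modulo `JannsenWingbergMappingClass`).**  Same packet; `r = (v − 1) mod e_{i₀}`;
`S` ANY finite set of factors (bits AVAILABLE there: at each `i ∈ S` with `f(w_i|p) = 1` some realised strip automorphism at `w_i` moves `ℤ_p·p` modulo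
`p·log_p(𝒪_{w_i}^×)`).  If `(r + 1)/e_{i₀} + Σ_{i ∉ S} 1/e_i ≤ 1`, then for every `H ≤ indTwo` containing the single-factor strip moves the `(R_I)^∼`-hull
of the `H`-orbit of `ι_{i₀}(g)·(R_I)^∼` IS `packetHull(p^{A}·log_p(R_I^×))`: the profile with FULL depth `e_i` on `S` and depth `e_i − 1` off `S` lies
inside the room exactly under the displayed inequality (§1; `Σ n_i/e_i = |I| − Σ_{i∉S} 1/e_i`, `v/e_{i₀} − A = (r+1)/e_{i₀} + |I| − 1`).  `S = ∅`: NO bit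
(`(r+2)/e_{i₀} + Σ_{i≠i₀} 1/e_i ≤ 1`); `S = {b}`: ONE bit anywhere (`(r+1)/e_{i₀} + Σ_{i≠b} 1/e_i ≤ 1`); `S = univ` (`E ∣ v`) / `univ ∖ {i₀}` (`E ∤ v`):
R24's p552192 §1 (room with equality / `(r+2)/e_{i₀} ≤ 1`) — file (A′) `Thm311RealInd1StripPacketMonomialFloorForms` displays these verbatim.
[claim: Mochizuki2012, status: disputed] [cite: Mochizuki2012, IUTchIII Thm. 3.11 (i) p. 154; Cor. 3.12 Step (xi) p. 183; IUTchIV Prop. 1.1 p. 9, Prop. 1.2 (ii) p. 10–11]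
[cite: Kondo2025OuterAutMLF, §3 Thm 3.17, Rem 3.18] [cite: DupuyHilado2025, §4.9, §4.12] -/
theorem packetHull_iUnion_image_iota_smul_normalizedPacket_eq_of_bitsOn_of_jannsenWingbergMappingClass [Nonempty I]
    (hMC : JannsenWingbergMappingClass) (hp2 : 2 < p)
    (he : ∀ i, absRamificationIdx p (RescaledCompletion K p (w i) (hw i)) ≤ p - 2)
    (h3 : ∀ i, 3 ≤ localDeg K (w i)) (hodd : ∀ i, Odd (localDeg K (w i)))
    (i₀ : I) {g : RescaledCompletion K p (w i₀) (hw i₀)} {v : ℤ}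
    (hv : ‖g‖ = (p : ℝ) ^ (-(v / (absRamificationIdx p (RescaledCompletion K p (w i₀) (hw i₀)) : ℝ))))
    (S : Finset I)
    (hroom : (((v - 1) % (absRamificationIdx p (RescaledCompletion K p (w i₀) (hw i₀)) : ℤ) + 1 : ℤ) : ℝ) /
        (absRamificationIdx p (RescaledCompletion K p (w i₀) (hw i₀)) : ℝ) +
      ∑ i ∈ Finset.univ \ S, (1 : ℝ) / (absRamificationIdx p (RescaledCompletion K p (w i) (hw i)) : ℝ) ≤ 1)
    (hbit : ∀ i ∈ S, (w i).asIdeal.inertiaDeg ℤ = 1 →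
      ∃ ψ ∈ ind1StripOf (w i) (galoisLog (w i)),
        RescaledCompletion.of K p (w i) (hw i) (ψ (p : (w i).adicCompletion K)) - (p : RescaledCompletion K p (w i) (hw i)) ∉
          (p : ℚ_[p]) • logUnits (RescaledCompletion K p (w i) (hw i)))
    (H : Subgroup (PacketAlgebra p (fun i => RescaledCompletion K p (w i) (hw i)) ≃ₗ[ℚ_[p]]
      PacketAlgebra p (fun i => RescaledCompletion K p (w i) (hw i))))
    (hH : H ≤ indTwo p (fun i => RescaledCompletion K p (w i) (hw i)))
    (hstrip : ∀ (i₁ : I), ∀ ψ ∈ ind1StripOf (w i₁) (galoisLog (w i₁)), ∃ γ ∈ H,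
      ∀ z : Π i, RescaledCompletion K p (w i) (hw i),
        (γ : PacketAlgebra p (fun i => RescaledCompletion K p (w i) (hw i)) ≃ₗ[ℚ_[p]]
            PacketAlgebra p (fun i => RescaledCompletion K p (w i) (hw i))) (PiTensorProduct.tprod ℚ_[p] z) =
          PiTensorProduct.tprod ℚ_[p] (update z i₁ (RescaledCompletion.of K p (w i₁) (hw i₁)
            (ψ ((RescaledCompletion.of K p (w i₁) (hw i₁)).symm (z i₁)))))) :
    packetHull p (fun i => RescaledCompletion K p (w i) (hw i))
        (⋃ γ : H, (γ : PacketAlgebra p (fun i => RescaledCompletion K p (w i) (hw i)) ≃ₗ[ℚ_[p]]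
            PacketAlgebra p (fun i => RescaledCompletion K p (w i) (hw i))) ''
          (iota p (fun i => RescaledCompletion K p (w i) (hw i)) i₀ g •
            (normalizedPacket p (fun i => RescaledCompletion K p (w i) (hw i)) :
              Set (PacketAlgebra p (fun i => RescaledCompletion K p (w i) (hw i)))))) =
      packetHull p (fun i => RescaledCompletion K p (w i) (hw i))
        (((p : ℚ_[p]) ^ ((v - 1) / (absRamificationIdx p (RescaledCompletion K p (w i₀) (hw i₀)) : ℤ) + 1 - Fintype.card I)) •
          (logPacket p (fun i => RescaledCompletion K p (w i) (hw i)) :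
            Set (PacketAlgebra p (fun i => RescaledCompletion K p (w i) (hw i))))) := by
  classical
  set k := fun i => RescaledCompletion K p (w i) (hw i) with hk
  set E : ℕ := absRamificationIdx p (k i₀) with hE
  have hE0 : 0 < E := absRamificationIdx_pos p (k i₀)
  have hE0z : (0 : ℤ) < (E : ℤ) := by exact_mod_cast hE0
  have hE0r : (0 : ℝ) < (E : ℝ) := by exact_mod_cast hE0
  have hei0 : ∀ i, (0 : ℝ) < (absRamificationIdx p (k i) : ℝ) := fun i => by exact_mod_cast absRamificationIdx_pos p (k i)
  -- `v − 1 = E·B + r`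
  set B : ℤ := (v - 1) / (E : ℤ) with hB
  set r : ℤ := (v - 1) % (E : ℤ) with hr
  have hr0 : 0 ≤ r := Int.emod_nonneg _ hE0z.ne'
  have hvR : (v : ℝ) = (E : ℝ) * B + r + 1 := by
    have hvar : v - 1 = (E : ℤ) * B + r := by rw [hr, Int.emod_def]; ring
    have h1 : v = (E : ℤ) * B + r + 1 := by omega
    exact_mod_cast h1
  -- the room inequality forces `e_i ≥ 2` off `S`
  have he2 : ∀ i, i ∉ S → 2 ≤ absRamificationIdx p (k i) := by
    intro i hi
    by_contra hlt
    have h1 : absRamificationIdx p (k i) = 1 := by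
      have := absRamificationIdx_pos p (k i); omega
    have hle : (1 : ℝ) / (absRamificationIdx p (k i) : ℝ) ≤ ∑ i ∈ Finset.univ \ S, (1 : ℝ) / (absRamificationIdx p (k i) : ℝ) :=
      Finset.single_le_sum (f := fun i => (1 : ℝ) / (absRamificationIdx p (k i) : ℝ)) (fun i _ => by positivity)
        (Finset.mem_sdiff.mpr ⟨Finset.mem_univ i, hi⟩)
    rw [h1, Nat.cast_one, div_one] at hle
    have hpos : 0 < ((r + 1 : ℤ) : ℝ) / (E : ℝ) := by
      apply div_pos _ hE0r
      exact_mod_cast (show (0 : ℤ) < r + 1 by omega)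
    linarith
  -- the profile: full depth `e_i` on `S`, depth `e_i − 1` off `S`
  let nn : I → ℕ := fun i => if i ∈ S then absRamificationIdx p (k i) else absRamificationIdx p (k i) - 1
  have hnn1 : ∀ i, 1 ≤ nn i := by
    intro i; by_cases hi : i ∈ S
    · simp only [nn, if_pos hi]; exact absRamificationIdx_pos p (k i)
    · have := he2 i hi; simp only [nn, if_neg hi]; omega
  have hnne : ∀ i, nn i ≤ absRamificationIdx p (k i) := by
    intro i; by_cases hi : i ∈ S
    · simp only [nn, if_pos hi]; exact le_rfl
    · simp only [nn, if_neg hi]; exact Nat.sub_le _ _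
  have hbit' : ∀ i, nn i = absRamificationIdx p (k i) → (w i).asIdeal.inertiaDeg ℤ = 1 →
      ∃ ψ ∈ ind1StripOf (w i) (galoisLog (w i)),
        RescaledCompletion.of K p (w i) (hw i) (ψ (p : (w i).adicCompletion K)) - (p : k i) ∉ (p : ℚ_[p]) • logUnits (k i) := by
    intro i hni hfi
    by_cases hi : i ∈ S
    · exact hbit i hi hfi
    · have := he2 i hi
      simp only [nn, if_neg hi] at hni
      omega
  -- the room: `Σ nn_i/e_i = |I| − Σ_{i∉S} 1/e_i ≥ v/E − A = (r+1)/E + |I| − 1`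
  have hroom' : (v : ℝ) / (E : ℝ) - (((v - 1) / (E : ℤ) + 1 - Fintype.card I : ℤ) : ℝ) ≤
      ∑ i, (nn i : ℝ) / (absRamificationIdx p (k i) : ℝ) := by
    have hterm : ∀ i, (nn i : ℝ) / (absRamificationIdx p (k i) : ℝ) =
        1 - (if i ∈ Finset.univ \ S then 1 / (absRamificationIdx p (k i) : ℝ) else 0) := by
      intro i
      by_cases hi : i ∈ S
      · simp only [nn, if_pos hi, Finset.mem_sdiff, Finset.mem_univ, hi, not_true_eq_false, and_false, if_false, sub_zero]
        field_simp [(hei0 i).ne']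
      · have := he2 i hi
        simp only [nn, if_neg hi, Finset.mem_sdiff, Finset.mem_univ, hi, not_false_eq_true, and_self, if_true]
        rw [Nat.cast_sub (by omega), Nat.cast_one]
        field_simp [(hei0 i).ne']
    rw [Finset.sum_congr rfl (fun i _ => hterm i), Finset.sum_sub_distrib, Finset.sum_const, Finset.card_univ,
      nsmul_eq_mul, mul_one, ← Finset.sum_filter, Finset.filter_mem_eq_inter, Finset.univ_inter]
    have hAR : (((v - 1) / (E : ℤ) + 1 - Fintype.card I : ℤ) : ℝ) = (B : ℝ) + 1 - Fintype.card I := by rw [hB]; push_cast; ring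
    have hvE : (v : ℝ) / (E : ℝ) = B + (r + 1) / (E : ℝ) := by
      rw [hvR]; field_simp; ring
    rw [hvE, hAR]
    have hroom2 : ((r : ℝ) + 1) / (E : ℝ) + ∑ i ∈ Finset.univ \ S, (1 : ℝ) / (absRamificationIdx p (k i) : ℝ) ≤ 1 := by
      have : (((r + 1 : ℤ)) : ℝ) = (r : ℝ) + 1 := by push_cast; ring
      rw [← this]; exact hroom
    change (B : ℝ) + ((r : ℝ) + 1) / (E : ℝ) - ((B : ℝ) + 1 - Fintype.card I) ≤
      (Fintype.card I : ℝ) - ∑ i ∈ Finset.univ \ S, (1 : ℝ) / (absRamificationIdx p (k i) : ℝ)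
    linarith
  exact packetHull_iUnion_image_iota_smul_normalizedPacket_eq_of_profile_of_jannsenWingbergMappingClass p w hw hMC hp2 he h3 hodd i₀ hv
    nn hnn1 hnne hroom' hbit' H hH hstrip

end GenuineFactors

end Summit.ABC.IUTFork.Thm311.Real
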